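import Summits.QuantumFields.YangMills.Theorems.AllWindowsColdBoxBoxHighLineRestrictionSetSlots

/-!
# U5 ε₂-glue (G3b-1): SLOT CALCULUS of the third cumulant at `t = 0` over `μ_{D′}` (general measurable `D′`) — trilinearity and the triple Hölder bound

Free-hands helper of the κ-lineage (ym-line-fcl-p3 g27) for Steps D–E of the NEXT rung U5 (`stub_landauThirdOrder`, LINE-20, ⟨stmt-QuantumFields-24336⟩).
ASSEMBLY-U5 §3 (planner ym-idea-2 g18): `f′(0) = −κ₃,₀(c₀, c_T; U)` over `μ_{D′}` is split by parity (✓`GaussRestrict.tiltCum3_muSet_zero_parity_split`) and then,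
slot by slot, into POLYNOMIAL pieces (→ D′-truncation transfer ✓`abs_tiltCum3_muSet_zero_sub_gaussCum3_le` → exact Wick, w3 g41) and REMAINDER pieces
(→ Hölder on `μ_{D′}`).  This file supplies the two generic tools of that splitting, over
`μ_D := (volume.restrict D).withDensity (ofReal ∘ gaussWeight β H)` for an ARBITRARY measurable `D` and observables measurable and bounded on `D`:

* §1 `tiltExp_zero_tilt_irrel` (`E_0` does not depend on the tilt letter), `tiltExp_muSet_congr_on`, ★`abs_tiltExp_muSet_triple_le`
  (`|E_t[XYZ]| ≤ √(√E_t[X⁴]·√E_t[Y⁴])·√E_t[Z²]` over `μ_D`, any `t` — LEAD g77's ✓`abs_tiltExp_muD_triple_le` re-lettered), and its `t = 0` Gaussian-letter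
  form `abs_tiltExp_muSet_zero_triple_le_gaussAvg` (every `μ_D`-moment replaced by `2·E₀[1_D·(…)]`, for `E₀[1 − 1_D] ≤ τ ≤ 1/2`);
* §2 ★ TRILINEARITY of `κ₃,₀` over `μ_D`: `tiltCum3_muSet_zero_eq_triple` (`κ₃,₀(X,Y;Z) = E_0[X̃ỸZ̃]` with ANY tilt letter), `tiltCum3_muSet_zero_add_left/right/third`,
  `tiltCum3_muSet_zero_const_mul_left/right/third` — so `κ₃,₀(L+R, ·; ·) = κ₃,₀(L, ·; ·) + κ₃,₀(R, ·; ·)` etc. peel polynomial pieces off remainders.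

No definitions; standard axioms.  HONEST LABEL: helper-grade glue for U5 prep; U5, ⟨24004⟩, ⟨24336⟩ remain OPEN; route AllWindowsColdBox is DRAFT;
no crux, rung or summit is proved; the Yang–Mills mass gap is NOT proved by this file; no summit is proved by a line.
-/

set_option autoImplicit false

noncomputable section

open MeasureTheory Set

namespace Summit.QuantumFields.YangMills.Theorems.AllWindowsColdBoxBoxHighLine

namespace GaussRestrict

variable {H : ℕ} {β : ℝ}

/-! ## §1 Tilt-letter irrelevance at `t = 0`, congruence on `D`, and the triple Hölder bound -/

/-- At `t = 0` the tilted expectation does not depend on the tilt letter. -/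
theorem tiltExp_zero_tilt_irrel {Ω : Type*} [MeasurableSpace Ω] (μ : Measure Ω) (U V G : Ω → ℝ) :
    Tilt.tiltExp μ U 0 G = Tilt.tiltExp μ V 0 G := by
  simp only [Tilt.tiltExp, zero_mul, Real.exp_zero, mul_one]

/-- At `t = 0` the third cumulant depends on the tilt letter only through its third slot: `κ₃,₀^{U}(X,Y) = E_0[(X−E_0X)(Y−E_0Y)(U−E_0U)]` with the
expectations taken in ANY tilt letter `V`. -/
theorem tiltCum3_zero_eq_triple {Ω : Type*} [MeasurableSpace Ω] (μ : Measure Ω) (U V X Y : Ω → ℝ) :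
    Tilt.tiltCum3 μ U 0 X Y =
      Tilt.tiltExp μ V 0 (fun x => (X x - Tilt.tiltExp μ V 0 X) * (Y x - Tilt.tiltExp μ V 0 Y) * (U x - Tilt.tiltExp μ V 0 U)) := by
  unfold Tilt.tiltCum3
  simp only [tiltExp_zero_tilt_irrel μ U V]

/-- `E_t[G]` over `μ_D` depends only on the values of `G` on `D`. -/
theorem tiltExp_muSet_congr_on (β : ℝ) {D : Set (LandauFree H → E3)} (hDm : MeasurableSet D) (U : (LandauFree H → E3) → ℝ) (t : ℝ)
    {G G' : (LandauFree H → E3) → ℝ} (h : ∀ a ∈ D, G a = G' a) :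
    Tilt.tiltExp ((((volume : Measure (LandauFree H → E3)).restrict D).withDensity fun a => ENNReal.ofReal (gaussWeight β H a))) U t G =
      Tilt.tiltExp ((((volume : Measure (LandauFree H → E3)).restrict D).withDensity fun a => ENNReal.ofReal (gaussWeight β H a))) U t G' := by
  unfold Tilt.tiltExp
  congr 1
  refine integral_congr_ae ((ae_muSet_mem β hDm).mono fun a ha => ?_)
  simp only [h a ha]

/-- ★ **Hölder `L⁴·L⁴·L²` over `μ_D` for observables bounded on `D`** (any `t`, any measurable `D`): `|E_t[XYZ]| ≤ √(√E_t[X⁴]·√E_t[Y⁴])·√E_t[Z²]`. -/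
theorem abs_tiltExp_muSet_triple_le (β : ℝ) {D : Set (LandauFree H → E3)} (hDm : MeasurableSet D) (U : (LandauFree H → E3) → ℝ) (t : ℝ)
    {X Y Z : (LandauFree H → E3) → ℝ} {B : ℝ} (hB : 0 ≤ B) (mX : Measurable X) (mY : Measurable Y) (mZ : Measurable Z)
    (bX : ∀ a ∈ D, |X a| ≤ B) (bY : ∀ a ∈ D, |Y a| ≤ B) (bZ : ∀ a ∈ D, |Z a| ≤ B) :
    |Tilt.tiltExp ((((volume : Measure (LandauFree H → E3)).restrict D).withDensity fun a => ENNReal.ofReal (gaussWeight β H a))) U t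
        (fun a => X a * Y a * Z a)| ≤
      Real.sqrt (Real.sqrt (Tilt.tiltExp ((((volume : Measure (LandauFree H → E3)).restrict D).withDensity fun a => ENNReal.ofReal (gaussWeight β H a))) U t
            (fun a => X a ^ 4)) *
          Real.sqrt (Tilt.tiltExp ((((volume : Measure (LandauFree H → E3)).restrict D).withDensity fun a => ENNReal.ofReal (gaussWeight β H a))) U t
            (fun a => Y a ^ 4))) *
        Real.sqrt (Tilt.tiltExp ((((volume : Measure (LandauFree H → E3)).restrict D).withDensity fun a => ENNReal.ofReal (gaussWeight β H a))) U t
          (fun a => Z a ^ 2)) := by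
  have hon : ∀ a ∈ D, D.indicator (fun _ => (1 : ℝ)) a = 1 := fun a ha => Set.indicator_of_mem ha _
  have eXYZ : ∀ a ∈ D, X a * Y a * Z a =
      (D.indicator (fun _ => (1 : ℝ)) a * X a) * (D.indicator (fun _ => (1 : ℝ)) a * Y a) * (D.indicator (fun _ => (1 : ℝ)) a * Z a) :=
    fun a ha => by rw [hon a ha]; ring
  have eX : ∀ a ∈ D, X a ^ 4 = (D.indicator (fun _ => (1 : ℝ)) a * X a) ^ 4 := fun a ha => by rw [hon a ha, one_mul]
  have eY : ∀ a ∈ D, Y a ^ 4 = (D.indicator (fun _ => (1 : ℝ)) a * Y a) ^ 4 := fun a ha => by rw [hon a ha, one_mul]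
  have eZ : ∀ a ∈ D, Z a ^ 2 = (D.indicator (fun _ => (1 : ℝ)) a * Z a) ^ 2 := fun a ha => by rw [hon a ha, one_mul]
  rw [tiltExp_muSet_congr_on β hDm U t eXYZ, tiltExp_muSet_congr_on β hDm U t eX, tiltExp_muSet_congr_on β hDm U t eY,
    tiltExp_muSet_congr_on β hDm U t eZ]
  have mI : Measurable (D.indicator (fun _ => (1 : ℝ))) := measurable_const.indicator hDm
  exact Tilt.abs_tiltExp_mul_mul_le (mI.mul mX) (mI.mul mY) (mI.mul mZ) (abs_indicator_one_mul_le hB bX) (abs_indicator_one_mul_le hB bY)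
    (abs_indicator_one_mul_le hB bZ) U t

/-- ★ **The triple Hölder bound at `t = 0` in Gaussian letters**: with `E₀[1 − 1_D] ≤ τ ≤ 1/2` every `μ_D`-moment is at most twice the truncated Gaussian one:
`|E_0[XYZ]| ≤ √(√(2E₀[1_D X⁴])·√(2E₀[1_D Y⁴]))·√(2E₀[1_D Z²])`. -/
theorem abs_tiltExp_muSet_zero_triple_le_gaussAvg (hβ : 0 < β) {D : Set (LandauFree H → E3)} (hDm : MeasurableSet D) {τ : ℝ}
    (hτ : gaussAvg β H (fun a => 1 - D.indicator (fun _ => (1 : ℝ)) a) ≤ τ) (hτ2 : τ ≤ 1 / 2) (U : (LandauFree H → E3) → ℝ)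
    {X Y Z : (LandauFree H → E3) → ℝ} {B : ℝ} (hB : 0 ≤ B) (mX : Measurable X) (mY : Measurable Y) (mZ : Measurable Z)
    (bX : ∀ a ∈ D, |X a| ≤ B) (bY : ∀ a ∈ D, |Y a| ≤ B) (bZ : ∀ a ∈ D, |Z a| ≤ B) :
    |Tilt.tiltExp ((((volume : Measure (LandauFree H → E3)).restrict D).withDensity fun a => ENNReal.ofReal (gaussWeight β H a))) U 0
        (fun a => X a * Y a * Z a)| ≤
      Real.sqrt (Real.sqrt (2 * gaussAvg β H (fun a => D.indicator (fun _ => (1 : ℝ)) a * X a ^ 4)) *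
          Real.sqrt (2 * gaussAvg β H (fun a => D.indicator (fun _ => (1 : ℝ)) a * Y a ^ 4))) *
        Real.sqrt (2 * gaussAvg β H (fun a => D.indicator (fun _ => (1 : ℝ)) a * Z a ^ 2)) := by
  have h := abs_tiltExp_muSet_triple_le β hDm U 0 hB mX mY mZ bX bY bZ
  -- each truncated moment: `E_0[W] = E_0[1_D·W] ≤ 2·E₀[1_D·W]` (the observables agree with their truncations on `D`)
  have mI : Measurable (D.indicator (fun _ => (1 : ℝ))) := measurable_const.indicator hDm
  have key : ∀ {W : (LandauFree H → E3) → ℝ} (n : ℕ), Measurable W → (∀ a ∈ D, |W a| ≤ B) →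
      Tilt.tiltExp ((((volume : Measure (LandauFree H → E3)).restrict D).withDensity fun a => ENNReal.ofReal (gaussWeight β H a))) U 0 (fun a => W a ^ (2 * n)) ≤
        2 * gaussAvg β H (fun a => D.indicator (fun _ => (1 : ℝ)) a * W a ^ (2 * n)) := by
    intro W n mW bW
    have eW : ∀ a ∈ D, W a ^ (2 * n) = D.indicator (fun _ => (1 : ℝ)) a * W a ^ (2 * n) := fun a ha => by
      rw [Set.indicator_of_mem ha, one_mul]
    rw [tiltExp_muSet_congr_on β hDm U 0 eW]
    have h0 : 0 ≤ fun a => D.indicator (fun _ => (1 : ℝ)) a * W a ^ (2 * n) := fun a =>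
      mul_nonneg (indicator_one_nonneg_le_one D a).1 (by rw [pow_mul]; exact pow_nonneg (sq_nonneg _) n)
    have hI : Integrable fun a => D.indicator (fun _ => (1 : ℝ)) a * W a ^ (2 * n) * gaussWeight β H a := by
      refine Tilt.integrable_bdd_mul_gaussWeight H hβ (mI.mul (mW.pow_const _)) (C := B ^ (2 * n)) fun a => ?_
      by_cases ha : a ∈ D
      · rw [Set.indicator_of_mem ha, one_mul, abs_pow]; exact pow_le_pow_left₀ (abs_nonneg _) (bW a ha) _
      · rw [Set.indicator_of_notMem ha, zero_mul, abs_zero]; positivity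
    exact tiltExp_muSet_zero_le_two_mul_gaussAvg hβ hDm hτ hτ2 U h0 hI
  have kX := key 2 mX bX
  have kY := key 2 mY bY
  have kZ := key 1 mZ bZ
  simp only [Nat.mul_one, show 2 * 2 = 4 from rfl] at kX kY kZ
  refine h.trans ?_
  gcongr

/-! ## §2 Trilinearity of `κ₃,₀` over `μ_D` -/

section Trilinear

variable (hβ : 0 < β) {D : Set (LandauFree H → E3)} (hDm : MeasurableSet D) (hD : 0 < ∫ a, D.indicator (fun _ => (1 : ℝ)) a * gaussWeight β H a)

/-- ★ **`κ₃,₀(X,Y;Z) = E_0[X̃ỸZ̃]` with the expectations in any tilt letter `V`** (the form every slot manipulation starts from). -/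
theorem tiltCum3_muSet_zero_eq_triple (U V X Y : (LandauFree H → E3) → ℝ) :
    Tilt.tiltCum3 ((((volume : Measure (LandauFree H → E3)).restrict D).withDensity fun a => ENNReal.ofReal (gaussWeight β H a))) U 0 X Y =
      Tilt.tiltExp ((((volume : Measure (LandauFree H → E3)).restrict D).withDensity fun a => ENNReal.ofReal (gaussWeight β H a))) V 0
        (fun a => (X a - Tilt.tiltExp ((((volume : Measure (LandauFree H → E3)).restrict D).withDensity fun a => ENNReal.ofReal (gaussWeight β H a))) V 0 X) *
          (Y a - Tilt.tiltExp ((((volume : Measure (LandauFree H → E3)).restrict D).withDensity fun a => ENNReal.ofReal (gaussWeight β H a))) V 0 Y) *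
          (U a - Tilt.tiltExp ((((volume : Measure (LandauFree H → E3)).restrict D).withDensity fun a => ENNReal.ofReal (gaussWeight β H a))) V 0 U)) :=
  tiltCum3_zero_eq_triple _ U V X Y

include hβ hDm hD in
/-- ★ **Additivity of `κ₃,₀` in the FIRST slot** over `μ_D` (observables measurable, bounded by `B` on `D`; `D` of positive Gaussian mass). -/
theorem tiltCum3_muSet_zero_add_left (U : (LandauFree H → E3) → ℝ) {F G Y : (LandauFree H → E3) → ℝ} {B : ℝ} (hB : 0 ≤ B)
    (mF : Measurable F) (mG : Measurable G) (mY : Measurable Y) (mU : Measurable U)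
    (bF : ∀ a ∈ D, |F a| ≤ B) (bG : ∀ a ∈ D, |G a| ≤ B) (bY : ∀ a ∈ D, |Y a| ≤ B) (bU : ∀ a ∈ D, |U a| ≤ B) :
    Tilt.tiltCum3 ((((volume : Measure (LandauFree H → E3)).restrict D).withDensity fun a => ENNReal.ofReal (gaussWeight β H a))) U 0 (fun a => F a + G a) Y =
      Tilt.tiltCum3 ((((volume : Measure (LandauFree H → E3)).restrict D).withDensity fun a => ENNReal.ofReal (gaussWeight β H a))) U 0 F Y +
        Tilt.tiltCum3 ((((volume : Measure (LandauFree H → E3)).restrict D).withDensity fun a => ENNReal.ofReal (gaussWeight β H a))) U 0 G Y := by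
  set μD := (((volume : Measure (LandauFree H → E3)).restrict D).withDensity fun a => ENNReal.ofReal (gaussWeight β H a)) with hμD
  unfold Tilt.tiltCum3
  rw [tiltExp_muSet_zero_add hβ hDm U hB mF mG bF bG]
  set mF' := Tilt.tiltExp μD U 0 F
  set mG' := Tilt.tiltExp μD U 0 G
  set mY' := Tilt.tiltExp μD U 0 Y
  set mU' := Tilt.tiltExp μD U 0 U
  have bmF : |mF'| ≤ B := abs_tiltExp_muSet_zero_le hβ hDm hD U hB bF
  have bmG : |mG'| ≤ B := abs_tiltExp_muSet_zero_le hβ hDm hD U hB bG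
  have bmY : |mY'| ≤ B := abs_tiltExp_muSet_zero_le hβ hDm hD U hB bY
  have bmU : |mU'| ≤ B := abs_tiltExp_muSet_zero_le hβ hDm hD U hB bU
  have e : (fun a => (F a + G a - (mF' + mG')) * (Y a - mY') * (U a - mU')) =
      fun a => (F a - mF') * (Y a - mY') * (U a - mU') + (G a - mG') * (Y a - mY') * (U a - mU') := by funext a; ring
  rw [e]
  have h2B : 0 ≤ 2 * B := by linarith
  have cen : ∀ {W : (LandauFree H → E3) → ℝ} {m : ℝ}, (∀ a ∈ D, |W a| ≤ B) → |m| ≤ B → ∀ a ∈ D, |W a - m| ≤ 2 * B :=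
    fun hW hm a ha => (abs_sub _ _).trans (by linarith [hW a ha])
  have trip : ∀ {P Q R : (LandauFree H → E3) → ℝ}, (∀ a ∈ D, |P a| ≤ 2 * B) → (∀ a ∈ D, |Q a| ≤ 2 * B) → (∀ a ∈ D, |R a| ≤ 2 * B) →
      ∀ a ∈ D, |P a * Q a * R a| ≤ (2 * B) ^ 3 := by
    intro P Q R hP hQ hR a ha
    rw [abs_mul, abs_mul]
    calc |P a| * |Q a| * |R a| ≤ 2 * B * (2 * B) * (2 * B) :=
          mul_le_mul (mul_le_mul (hP a ha) (hQ a ha) (abs_nonneg _) h2B) (hR a ha) (abs_nonneg _) (by positivity)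
      _ = (2 * B) ^ 3 := by ring
  exact tiltExp_muSet_zero_add hβ hDm U (by positivity) (((mF.sub measurable_const).mul (mY.sub measurable_const)).mul (mU.sub measurable_const))
    (((mG.sub measurable_const).mul (mY.sub measurable_const)).mul (mU.sub measurable_const))
    (trip (cen bF bmF) (cen bY bmY) (cen bU bmU)) (trip (cen bG bmG) (cen bY bmY) (cen bU bmU))

include hβ hDm hD in
/-- ★ **Additivity of `κ₃,₀` in the SECOND slot** over `μ_D`. -/
theorem tiltCum3_muSet_zero_add_right (U : (LandauFree H → E3) → ℝ) {X F G : (LandauFree H → E3) → ℝ} {B : ℝ} (hB : 0 ≤ B)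
    (mX : Measurable X) (mF : Measurable F) (mG : Measurable G) (mU : Measurable U)
    (bX : ∀ a ∈ D, |X a| ≤ B) (bF : ∀ a ∈ D, |F a| ≤ B) (bG : ∀ a ∈ D, |G a| ≤ B) (bU : ∀ a ∈ D, |U a| ≤ B) :
    Tilt.tiltCum3 ((((volume : Measure (LandauFree H → E3)).restrict D).withDensity fun a => ENNReal.ofReal (gaussWeight β H a))) U 0 X (fun a => F a + G a) =
      Tilt.tiltCum3 ((((volume : Measure (LandauFree H → E3)).restrict D).withDensity fun a => ENNReal.ofReal (gaussWeight β H a))) U 0 X F +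
        Tilt.tiltCum3 ((((volume : Measure (LandauFree H → E3)).restrict D).withDensity fun a => ENNReal.ofReal (gaussWeight β H a))) U 0 X G := by
  set μD := (((volume : Measure (LandauFree H → E3)).restrict D).withDensity fun a => ENNReal.ofReal (gaussWeight β H a)) with hμD
  unfold Tilt.tiltCum3
  rw [tiltExp_muSet_zero_add hβ hDm U hB mF mG bF bG]
  set mX' := Tilt.tiltExp μD U 0 X
  set mF' := Tilt.tiltExp μD U 0 F
  set mG' := Tilt.tiltExp μD U 0 G
  set mU' := Tilt.tiltExp μD U 0 U
  have bmX : |mX'| ≤ B := abs_tiltExp_muSet_zero_le hβ hDm hD U hB bX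
  have bmF : |mF'| ≤ B := abs_tiltExp_muSet_zero_le hβ hDm hD U hB bF
  have bmG : |mG'| ≤ B := abs_tiltExp_muSet_zero_le hβ hDm hD U hB bG
  have bmU : |mU'| ≤ B := abs_tiltExp_muSet_zero_le hβ hDm hD U hB bU
  have e : (fun a => (X a - mX') * (F a + G a - (mF' + mG')) * (U a - mU')) =
      fun a => (X a - mX') * (F a - mF') * (U a - mU') + (X a - mX') * (G a - mG') * (U a - mU') := by funext a; ring
  rw [e]
  have h2B : 0 ≤ 2 * B := by linarith
  have cen : ∀ {W : (LandauFree H → E3) → ℝ} {m : ℝ}, (∀ a ∈ D, |W a| ≤ B) → |m| ≤ B → ∀ a ∈ D, |W a - m| ≤ 2 * B :=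
    fun hW hm a ha => (abs_sub _ _).trans (by linarith [hW a ha])
  have trip : ∀ {P Q R : (LandauFree H → E3) → ℝ}, (∀ a ∈ D, |P a| ≤ 2 * B) → (∀ a ∈ D, |Q a| ≤ 2 * B) → (∀ a ∈ D, |R a| ≤ 2 * B) →
      ∀ a ∈ D, |P a * Q a * R a| ≤ (2 * B) ^ 3 := by
    intro P Q R hP hQ hR a ha
    rw [abs_mul, abs_mul]
    calc |P a| * |Q a| * |R a| ≤ 2 * B * (2 * B) * (2 * B) :=
          mul_le_mul (mul_le_mul (hP a ha) (hQ a ha) (abs_nonneg _) h2B) (hR a ha) (abs_nonneg _) (by positivity)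
      _ = (2 * B) ^ 3 := by ring
  exact tiltExp_muSet_zero_add hβ hDm U (by positivity) (((mX.sub measurable_const).mul (mF.sub measurable_const)).mul (mU.sub measurable_const))
    (((mX.sub measurable_const).mul (mG.sub measurable_const)).mul (mU.sub measurable_const))
    (trip (cen bX bmX) (cen bF bmF) (cen bU bmU)) (trip (cen bX bmX) (cen bG bmG) (cen bU bmU))

include hβ hDm hD in
/-- ★ **Additivity of `κ₃,₀` in the THIRD (tilt) slot** over `μ_D`: `κ₃,₀(X,Y; U+V) = κ₃,₀(X,Y; U) + κ₃,₀(X,Y; V)`. -/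
theorem tiltCum3_muSet_zero_add_third {X Y U V : (LandauFree H → E3) → ℝ} {B : ℝ} (hB : 0 ≤ B)
    (mX : Measurable X) (mY : Measurable Y) (mU : Measurable U) (mV : Measurable V)
    (bX : ∀ a ∈ D, |X a| ≤ B) (bY : ∀ a ∈ D, |Y a| ≤ B) (bU : ∀ a ∈ D, |U a| ≤ B) (bV : ∀ a ∈ D, |V a| ≤ B) :
    Tilt.tiltCum3 ((((volume : Measure (LandauFree H → E3)).restrict D).withDensity fun a => ENNReal.ofReal (gaussWeight β H a))) (fun a => U a + V a) 0 X Y =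
      Tilt.tiltCum3 ((((volume : Measure (LandauFree H → E3)).restrict D).withDensity fun a => ENNReal.ofReal (gaussWeight β H a))) U 0 X Y +
        Tilt.tiltCum3 ((((volume : Measure (LandauFree H → E3)).restrict D).withDensity fun a => ENNReal.ofReal (gaussWeight β H a))) V 0 X Y := by
  set μD := (((volume : Measure (LandauFree H → E3)).restrict D).withDensity fun a => ENNReal.ofReal (gaussWeight β H a)) with hμD
  -- all three cumulants in the tilt letter `U`
  rw [tiltCum3_zero_eq_triple μD (fun a => U a + V a) U X Y, tiltCum3_zero_eq_triple μD V U X Y]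
  unfold Tilt.tiltCum3
  rw [tiltExp_muSet_zero_add hβ hDm U hB mU mV bU bV]
  set mX' := Tilt.tiltExp μD U 0 X
  set mY' := Tilt.tiltExp μD U 0 Y
  set mU' := Tilt.tiltExp μD U 0 U
  set mV' := Tilt.tiltExp μD U 0 V
  have bmX : |mX'| ≤ B := abs_tiltExp_muSet_zero_le hβ hDm hD U hB bX
  have bmY : |mY'| ≤ B := abs_tiltExp_muSet_zero_le hβ hDm hD U hB bY
  have bmU : |mU'| ≤ B := abs_tiltExp_muSet_zero_le hβ hDm hD U hB bU
  have bmV : |mV'| ≤ B := abs_tiltExp_muSet_zero_le hβ hDm hD U hB bV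
  have e : (fun a => (X a - mX') * (Y a - mY') * (U a + V a - (mU' + mV'))) =
      fun a => (X a - mX') * (Y a - mY') * (U a - mU') + (X a - mX') * (Y a - mY') * (V a - mV') := by funext a; ring
  rw [e]
  have h2B : 0 ≤ 2 * B := by linarith
  have cen : ∀ {W : (LandauFree H → E3) → ℝ} {m : ℝ}, (∀ a ∈ D, |W a| ≤ B) → |m| ≤ B → ∀ a ∈ D, |W a - m| ≤ 2 * B :=
    fun hW hm a ha => (abs_sub _ _).trans (by linarith [hW a ha])
  have trip : ∀ {P Q R : (LandauFree H → E3) → ℝ}, (∀ a ∈ D, |P a| ≤ 2 * B) → (∀ a ∈ D, |Q a| ≤ 2 * B) → (∀ a ∈ D, |R a| ≤ 2 * B) →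
      ∀ a ∈ D, |P a * Q a * R a| ≤ (2 * B) ^ 3 := by
    intro P Q R hP hQ hR a ha
    rw [abs_mul, abs_mul]
    calc |P a| * |Q a| * |R a| ≤ 2 * B * (2 * B) * (2 * B) :=
          mul_le_mul (mul_le_mul (hP a ha) (hQ a ha) (abs_nonneg _) h2B) (hR a ha) (abs_nonneg _) (by positivity)
      _ = (2 * B) ^ 3 := by ring
  exact tiltExp_muSet_zero_add hβ hDm U (by positivity) (((mX.sub measurable_const).mul (mY.sub measurable_const)).mul (mU.sub measurable_const))
    (((mX.sub measurable_const).mul (mY.sub measurable_const)).mul (mV.sub measurable_const))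
    (trip (cen bX bmX) (cen bY bmY) (cen bU bmU)) (trip (cen bX bmX) (cen bY bmY) (cen bV bmV))

/-- **Homogeneity of `κ₃,₀` in the first slot** (any measure, any tilt letter): `κ₃,₀(c·X, Y; U) = c·κ₃,₀(X, Y; U)`. -/
theorem tiltCum3_zero_const_mul_left {Ω : Type*} [MeasurableSpace Ω] (μ : Measure Ω) (U X Y : Ω → ℝ) (c : ℝ) :
    Tilt.tiltCum3 μ U 0 (fun x => c * X x) Y = c * Tilt.tiltCum3 μ U 0 X Y := by
  unfold Tilt.tiltCum3
  rw [Tilt.tiltExp_const_mul U 0 c X,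
    ← Tilt.tiltExp_const_mul U 0 c (fun x => (X x - Tilt.tiltExp μ U 0 X) * (Y x - Tilt.tiltExp μ U 0 Y) * (U x - Tilt.tiltExp μ U 0 U))]
  congr 1; funext x; dsimp only; ring

/-- **Homogeneity of `κ₃,₀` in the second slot.** -/
theorem tiltCum3_zero_const_mul_right {Ω : Type*} [MeasurableSpace Ω] (μ : Measure Ω) (U X Y : Ω → ℝ) (c : ℝ) :
    Tilt.tiltCum3 μ U 0 X (fun x => c * Y x) = c * Tilt.tiltCum3 μ U 0 X Y := by
  unfold Tilt.tiltCum3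
  rw [Tilt.tiltExp_const_mul U 0 c Y,
    ← Tilt.tiltExp_const_mul U 0 c (fun x => (X x - Tilt.tiltExp μ U 0 X) * (Y x - Tilt.tiltExp μ U 0 Y) * (U x - Tilt.tiltExp μ U 0 U))]
  congr 1; funext x; dsimp only; ring

/-- **Homogeneity of `κ₃,₀` in the third (tilt) slot.** -/
theorem tiltCum3_zero_const_mul_third {Ω : Type*} [MeasurableSpace Ω] (μ : Measure Ω) (U X Y : Ω → ℝ) (c : ℝ) :
    Tilt.tiltCum3 μ (fun x => c * U x) 0 X Y = c * Tilt.tiltCum3 μ U 0 X Y := by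
  rw [tiltCum3_zero_eq_triple μ (fun x => c * U x) U X Y]
  unfold Tilt.tiltCum3
  rw [Tilt.tiltExp_const_mul U 0 c U,
    ← Tilt.tiltExp_const_mul U 0 c (fun x => (X x - Tilt.tiltExp μ U 0 X) * (Y x - Tilt.tiltExp μ U 0 Y) * (U x - Tilt.tiltExp μ U 0 U))]
  congr 1; funext x; ring

end Trilinear

end GaussRestrict

end Summit.QuantumFields.YangMills.Theorems.AllWindowsColdBoxBoxHighLine

end
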